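import Literature.Probability.RandomMatrix.TwoQubitSeparabilityVolumes
import HarnessLib

/-!
# Lovas–Andai 2017 (two rebits): the full-space separability probability versus the fibre over
# the maximally mixed marginal — Corollary 2 (invariance over reduced states) and the reduction
# of Theorem 2 to the fibre, both ways

Sibling proof file of `Literature/Probability/RandomMatrix/TwoQubitSeparabilityVolumes.lean` for
the REBIT facts `LovasAndai2017_rebit_separability_probability` (entry chart `ℝ⁹`) and
`LovasAndai2017_rebit_fibre_separability_probability` (fibre chart `ℝ⁷`). Statements unchanged;
nothing is defined here; everything lives in the paper sub-namespace
`Literature.Probability.RandomMatrix.LovasAndai2017` (the qubit analogue, sub-namespace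
`HuongKhoi2024`, is the sibling file `TwoQubitSeparabilityVolumesProofs.lean` of the qubit seat, and
the fibre value `29/64` itself is attacked in `TwoQubitSeparabilityVolumesRebitFibreProofs.lean`).

What is proved, sorry-free — the step of the printed proof of [LovasAndai2017, Theorem 2] that
passes between the whole state space and one fibre:

* `LovasAndai2017.rebit_volume_eq_const_mul_fibre_volume` — there is one constant `K` with
  `Vol(𝒟_{4,ℝ}) = K · Vol(𝒟_{4,ℝ}(½·1))` and `Vol(𝒟ˢ_{4,ℝ}) = K · Vol(𝒟ˢ_{4,ℝ}(½·1))`. This is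
  Corollary 2 of the source at `𝕂 = ℝ` ("the probability to find a separable state in `𝒟_{4,𝕂}(D)`
  … does not depend on `D`", Milz–Strunz's conjecture) in the cross-multiplied form the facts use,
  obtained exactly as in the proof of Theorem 1 there: on the fibre over a faithful marginal `D`
  the congruence `ρ ↦ (1 ⊗ M) ρ (1 ⊗ M)ᵀ` with `M D Mᵀ = ½·1` (the source's
  `Y = D^{-1/2} A D^{-1/2}`) is a linear bijection onto the fibre over `½·1` which preserves `ρ > 0`
  and `T ρ > 0` (it commutes with the partial transpose `T`), so both fibre volumes pick up the
  SAME Jacobian; then Fubini over `D`.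
* `LovasAndai2017.rebit_separability_probability_iff_fibre` — the constant is positive and finite
  (both bodies are bounded open sets containing `¼·1`), so the two named facts are EQUIVALENT; the
  two directions are `LovasAndai2017.rebit_separability_probability_of_fibre` (Theorem 2 on `ℝ⁹`
  from its fibre version, which is how the source proves it: Cor. 2, then the fibre integral with
  Lemma 6) and `LovasAndai2017.rebit_fibre_separability_probability_of_full`.
  The fibre value (Lemma 6 = Appendix A, and the integration by parts with dilogarithms in the
  proof of Thm. 2) is NOT proved here.

Ingredients, all proved here: openness (hence measurability) of the positive-definite locus of a
continuous family of symmetric matrices (`isOpen_setOf_posDef`, compactness of the unit sphere);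
boundedness and non-emptiness of both bodies; the measure-preserving change to marginal/fibre
coordinates `y ↦ (y₀+y₃, y₂+y₄, (y₀,y₁,y₂,y₅,…,y₈))` (two transvections and a regrouping,
`measurePreserving_baseFibre`); the block identities `(1 ⊗ M) ρ (1 ⊗ M)ᵀ = ρ_fibre(M X Mᵀ, M Z Mᵀ)`
and its partial-transposed twin (steps `id1`, `id2` of `exists_fibre_volume_eq`); faithfulness of
the marginal of a faithful state (`posDef_marginal`); the normalising lower-triangular `M`
(`exists_conj_eq_half`); `Measure.addHaar_preimage_linearMap` for the fibre Jacobian and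
`Measure.prod_apply` (twice) for Fubini.

History: an earlier copy of the reduction half of this file was landed as
`TwoQubitSeparabilityVolumesProofs.lean` (p46993), unknowingly replacing the qubit seat's file of the
same name (p46520, sub-namespace `HuongKhoi2024`); this file re-homes the rebit material under its
own name and namespace so that `TwoQubitSeparabilityVolumesProofs.lean` can be given back to the
qubit material.

## References

* [LovasAndai2017] A. Lovas, A. Andai, *Invariance of separability probability over reduced states
  in 4 × 4 bipartite systems*, J. Phys. A 50 (2017) 295303, arXiv:1610.01410: §3, Theorem 1 (and
  its proof: Lemma 1 = Schur complement, the substitutions `X = D₁^{-1/2} C D₂^{-1/2}`,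
  `Y = D^{-1/2} A D^{-1/2}`), Corollary 2 (independence of `D`), Theorem 2 (`29/64`).
-/

open MeasureTheory Matrix Set Filter Topology
open scoped ENNReal Matrix

namespace Literature.Probability.RandomMatrix.LovasAndai2017


/-- The positive-definite locus of a continuous family of real symmetric matrices is open.
[folklore] -/
theorem isOpen_setOf_posDef {X ι : Type*} [TopologicalSpace X] [Fintype ι] [DecidableEq ι]
    {f : X → Matrix ι ι ℝ} (hf : Continuous f) (hH : ∀ x, (f x).IsHermitian) :
    IsOpen {x | (f x).PosDef} := by
  rw [isOpen_iff_mem_nhds]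
  intro x₀ hx₀
  have hK : IsCompact (Metric.sphere (0 : ι → ℝ) 1) := isCompact_sphere 0 1
  have hP : ∀ v ∈ Metric.sphere (0 : ι → ℝ) 1,
      ∀ᶠ z : X × (ι → ℝ) in 𝓝 (x₀, v), 0 < z.2 ⬝ᵥ (f z.1 *ᵥ z.2) := by
    intro v hv
    have hv0 : v ≠ 0 := by
      intro h
      rw [h, mem_sphere_zero_iff_norm, norm_zero] at hv
      exact zero_ne_one hv
    have hcont : Continuous fun z : X × (ι → ℝ) => z.2 ⬝ᵥ (f z.1 *ᵥ z.2) :=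
      continuous_snd.dotProduct ((hf.comp continuous_fst).matrix_mulVec continuous_snd)
    have h0 : 0 < v ⬝ᵥ (f x₀ *ᵥ v) := by
      simpa using (Set.mem_setOf.mp hx₀).dotProduct_mulVec_pos hv0
    exact hcont.continuousAt.eventually_const_lt h0
  have hev := hK.eventually_forall_of_forall_eventually
    (P := fun x v => 0 < v ⬝ᵥ (f x *ᵥ v)) hP
  refine Filter.mem_of_superset hev ?_
  intro x hx
  refine Matrix.PosDef.of_dotProduct_mulVec_pos (hH x) fun w hw => ?_
  have hnorm : 0 < ‖w‖ := norm_pos_iff.mpr hw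
  have hu1 : ‖w‖⁻¹ • w ∈ Metric.sphere (0 : ι → ℝ) 1 := by
    rw [mem_sphere_zero_iff_norm, norm_smul, norm_inv, norm_norm, inv_mul_cancel₀ hnorm.ne']
  have hpos := hx _ hu1
  have hw' : w = ‖w‖ • (‖w‖⁻¹ • w) := by
    rw [smul_inv_smul₀ hnorm.ne']
  rw [star_trivial, hw', Matrix.mulVec_smul, dotProduct_smul, smul_dotProduct, smul_eq_mul, smul_eq_mul]
  positivity

/-- A positive definite real matrix has positive quadratic form `∑ᵢⱼ wᵢ Mᵢⱼ wⱼ` at every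
nonzero test vector (coordinate form used for explicit evaluations). [folklore] -/
theorem posDef_sum_pos_of_ne_zero {ι : Type*} [Fintype ι] [DecidableEq ι] {M : Matrix ι ι ℝ}
    (hM : M.PosDef) (w : ι → ℝ) (hw : w ≠ 0) : 0 < ∑ i, w i * ∑ j, M i j * w j := by
  have := hM.dotProduct_mulVec_pos hw
  simpa [dotProduct, Matrix.mulVec, star_trivial] using this

/-! #### The charts are symmetric and continuous -/

/-- [folklore] -/
theorem isHermitian_twoRebitMatrix (y : Fin 9 → ℝ) : (twoRebitMatrix y).IsHermitian := by
  apply Matrix.IsHermitian.ext; intro i j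
  fin_cases i <;> fin_cases j <;> simp [twoRebitMatrix]

/-- [folklore] -/
theorem isHermitian_twoRebitMatrixPT (y : Fin 9 → ℝ) : (twoRebitMatrixPT y).IsHermitian := by
  apply Matrix.IsHermitian.ext; intro i j
  fin_cases i <;> fin_cases j <;> simp [twoRebitMatrixPT]

/-- [folklore] -/
theorem isHermitian_rebitFibreMatrix (x : Fin 7 → ℝ) : (rebitFibreMatrix x).IsHermitian := by
  apply Matrix.IsHermitian.ext; intro i j
  fin_cases i <;> fin_cases j <;> simp [rebitFibreMatrix]

/-- [folklore] -/
theorem isHermitian_rebitFibreMatrixPT (x : Fin 7 → ℝ) : (rebitFibreMatrixPT x).IsHermitian := by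
  apply Matrix.IsHermitian.ext; intro i j
  fin_cases i <;> fin_cases j <;> simp [rebitFibreMatrixPT]

/-- [folklore] -/
theorem continuous_twoRebitMatrix : Continuous twoRebitMatrix := by
  refine continuous_pi fun i => continuous_pi fun j => ?_
  fin_cases i <;> fin_cases j <;> simp [twoRebitMatrix] <;> fun_prop

/-- [folklore] -/
theorem continuous_twoRebitMatrixPT : Continuous twoRebitMatrixPT := by
  refine continuous_pi fun i => continuous_pi fun j => ?_
  fin_cases i <;> fin_cases j <;> simp [twoRebitMatrixPT] <;> fun_prop

/-- [folklore] -/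
theorem continuous_rebitFibreMatrix : Continuous rebitFibreMatrix := by
  refine continuous_pi fun i => continuous_pi fun j => ?_
  fin_cases i <;> fin_cases j <;> simp [rebitFibreMatrix] <;> fun_prop

/-- [folklore] -/
theorem continuous_rebitFibreMatrixPT : Continuous rebitFibreMatrixPT := by
  refine continuous_pi fun i => continuous_pi fun j => ?_
  fin_cases i <;> fin_cases j <;> simp [rebitFibreMatrixPT] <;> fun_prop

/-- The set of faithful two-rebit states (entry chart) is open, hence Lebesgue measurable. [folklore] -/
theorem measurableSet_posDef_twoRebit :
    MeasurableSet {y : Fin 9 → ℝ | (twoRebitMatrix y).PosDef} :=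
  (isOpen_setOf_posDef continuous_twoRebitMatrix isHermitian_twoRebitMatrix).measurableSet

/-- The PPT part of the two-rebit body is open, hence measurable. [folklore] -/
theorem measurableSet_ppt_twoRebit :
    MeasurableSet {y : Fin 9 → ℝ | (twoRebitMatrix y).PosDef ∧ (twoRebitMatrixPT y).PosDef} :=
  ((isOpen_setOf_posDef continuous_twoRebitMatrix isHermitian_twoRebitMatrix).inter
    (isOpen_setOf_posDef continuous_twoRebitMatrixPT isHermitian_twoRebitMatrixPT)).measurableSet

/-! #### The fibre body is bounded -/

/-- Every point of the two-rebit fibre body lies in the cube `(-1, 1)⁷`. [folklore] -/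
theorem abs_lt_one_of_posDef_rebitFibreMatrix {x : Fin 7 → ℝ} (hx : (rebitFibreMatrix x).PosDef)
    (i : Fin 7) : x i ∈ Set.Ioo (-1 : ℝ) 1 := by
  have q := fun w hw => posDef_sum_pos_of_ne_zero hx w hw
  have ne : ∀ w : Fin 4 → ℝ, (∃ i, w i ≠ 0) → w ≠ 0 := fun w ⟨i, hi⟩ h => hi (by simp [h])
  have h0 := q ![1, 0, 0, 0] (ne _ ⟨0, by simp⟩)
  have h1 := q ![0, 1, 0, 0] (ne _ ⟨1, by simp⟩)
  have h2 := q ![0, 0, 1, 0] (ne _ ⟨2, by simp⟩)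
  have h3 := q ![0, 0, 0, 1] (ne _ ⟨3, by simp⟩)
  have h4 := q ![1, 1, 0, 0] (ne _ ⟨0, by simp⟩)
  have h5 := q ![1, -1, 0, 0] (ne _ ⟨0, by simp⟩)
  have h6 := q ![1, 0, 1, 0] (ne _ ⟨0, by simp⟩)
  have h7 := q ![1, 0, -1, 0] (ne _ ⟨0, by simp⟩)
  have h8 := q ![1, 0, 0, 1] (ne _ ⟨0, by simp⟩)
  have h9 := q ![1, 0, 0, -1] (ne _ ⟨0, by simp⟩)
  have h10 := q ![0, 1, 1, 0] (ne _ ⟨1, by simp⟩)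
  have h11 := q ![0, 1, -1, 0] (ne _ ⟨1, by simp⟩)
  have h12 := q ![0, 1, 0, 1] (ne _ ⟨1, by simp⟩)
  have h13 := q ![0, 1, 0, -1] (ne _ ⟨1, by simp⟩)
  simp [rebitFibreMatrix, Fin.sum_univ_four] at h0 h1 h2 h3 h4 h5 h6 h7 h8 h9 h10 h11 h12 h13
  simp only [Set.mem_Ioo]
  fin_cases i <;> simp <;> constructor <;> nlinarith

/-- The two-rebit fibre body has finite volume. [folklore] -/
theorem volume_posDef_rebitFibre_lt_top :
    volume {x : Fin 7 → ℝ | (rebitFibreMatrix x).PosDef} < ∞ := by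
  refine lt_of_le_of_lt (measure_mono (t := Set.pi Set.univ fun _ => Set.Ioo (-1 : ℝ) 1) ?_) ?_
  · intro x hx
    exact fun i _ => abs_lt_one_of_posDef_rebitFibreMatrix hx i
  · rw [volume_pi_pi]
    simp [Real.volume_Ioo]


/-! #### Coordinates: base `(a, b)` of the marginal `D = X + Y` and fibre `v ∈ ℝ⁷`

The entry chart `y ∈ ℝ⁹` is re-parametrised by the marginal coordinates `a = y₀ + y₃`,
`b = y₂ + y₄` of `D = X + Y = [[a, b], [b, 1 - a]]` and the fibre coordinates
`v = (y₀, y₁, y₂, y₅, y₆, y₇, y₈)`, i.e. `y = (v₀, v₁, v₂, a - v₀, b - v₂, v₃, v₄, v₅, v₆)`. -/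

/-- The base/fibre coordinates invert the parametrisation. [folklore] -/
theorem baseFibre_apply_self (y : Fin 9 → ℝ) :
    (![(![y 0, y 1, y 2, y 5, y 6, y 7, y 8] : Fin 7 → ℝ) 0, (![y 0, y 1, y 2, y 5, y 6, y 7, y 8] : Fin 7 → ℝ) 1,
      (![y 0, y 1, y 2, y 5, y 6, y 7, y 8] : Fin 7 → ℝ) 2, (y 0 + y 3) - (![y 0, y 1, y 2, y 5, y 6, y 7, y 8] : Fin 7 → ℝ) 0,
      (y 2 + y 4) - (![y 0, y 1, y 2, y 5, y 6, y 7, y 8] : Fin 7 → ℝ) 2, (![y 0, y 1, y 2, y 5, y 6, y 7, y 8] : Fin 7 → ℝ) 3,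
      (![y 0, y 1, y 2, y 5, y 6, y 7, y 8] : Fin 7 → ℝ) 4, (![y 0, y 1, y 2, y 5, y 6, y 7, y 8] : Fin 7 → ℝ) 5,
      (![y 0, y 1, y 2, y 5, y 6, y 7, y 8] : Fin 7 → ℝ) 6] : Fin 9 → ℝ) = y := by
  funext i
  fin_cases i <;> simp

/-- The parametrisation `(a, b, v) ↦ y` is (jointly) measurable — it is continuous. [folklore] -/
theorem measurable_baseFibre_symm : Measurable (fun p : ℝ × ℝ × (Fin 7 → ℝ) =>
    (![p.2.2 0, p.2.2 1, p.2.2 2, p.1 - p.2.2 0, p.2.1 - p.2.2 2, p.2.2 3, p.2.2 4, p.2.2 5, p.2.2 6] :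
      Fin 9 → ℝ)) := by
  refine Continuous.measurable (continuous_pi fun i => ?_)
  fin_cases i <;> simp <;> fun_prop

/-- The coordinate change `y ↦ (y₀+y₃, y₂+y₄, (y₀,y₁,y₂,y₅,…,y₈)) : ℝ⁹ → ℝ × ℝ × ℝ⁷` preserves Lebesgue
measure: it is the composition of two shears (transvections, `Real.volume_preserving_transvectionStruct`)
with a regrouping of coordinates (`volume_preserving_piFinSuccAbove`). [folklore] -/
theorem measurePreserving_baseFibre :
    MeasurePreserving (fun y : Fin 9 → ℝ =>
      ((y 0 + y 3, y 2 + y 4, (![y 0, y 1, y 2, y 5, y 6, y 7, y 8] : Fin 7 → ℝ)) :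
        ℝ × ℝ × (Fin 7 → ℝ))) volume volume := by
  have h1 := Real.volume_preserving_transvectionStruct
    (⟨3, 0, by decide, 1⟩ : TransvectionStruct (Fin 9) ℝ)
  have h2 := Real.volume_preserving_transvectionStruct
    (⟨4, 2, by decide, 1⟩ : TransvectionStruct (Fin 9) ℝ)
  have h3 := volume_preserving_piFinSuccAbove (fun _ : Fin 9 => ℝ) 3
  have h4 := volume_preserving_piFinSuccAbove (fun _ : Fin 8 => ℝ) 3
  have h5 : MeasurePreserving
      (Prod.map (id : ℝ → ℝ) (MeasurableEquiv.piFinSuccAbove (fun _ : Fin 8 => ℝ) 3))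
      (volume : Measure (ℝ × (Fin 8 → ℝ))) (volume : Measure (ℝ × (ℝ × (Fin 7 → ℝ)))) :=
    (MeasurePreserving.id volume).prod h4
  have h := ((h5.comp h3).comp h1).comp h2
  have hT : ∀ y : Fin 9 → ℝ,
      Matrix.transvection (3 : Fin 9) 0 (1 : ℝ) *ᵥ (Matrix.transvection (4 : Fin 9) 2 (1 : ℝ) *ᵥ y) =
        ![y 0, y 1, y 2, y 0 + y 3, y 2 + y 4, y 5, y 6, y 7, y 8] := by
    intro y
    funext j
    fin_cases j <;> simp [Matrix.transvection, Matrix.add_mulVec, Matrix.single_mulVec] <;> ring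
  have hfun : (fun y : Fin 9 → ℝ =>
      ((y 0 + y 3, y 2 + y 4, (![y 0, y 1, y 2, y 5, y 6, y 7, y 8] : Fin 7 → ℝ)) :
        ℝ × ℝ × (Fin 7 → ℝ))) =
      ((Prod.map (id : ℝ → ℝ) (MeasurableEquiv.piFinSuccAbove (fun _ : Fin 8 => ℝ) 3)) ∘
        (MeasurableEquiv.piFinSuccAbove (fun _ : Fin 9 => ℝ) 3)) ∘
        (Matrix.toLin' (⟨3, 0, by decide, 1⟩ : TransvectionStruct (Fin 9) ℝ).toMatrix) ∘
        (Matrix.toLin' (⟨4, 2, by decide, 1⟩ : TransvectionStruct (Fin 9) ℝ).toMatrix) := by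
    funext y
    simp only [Function.comp_apply, Matrix.toLin'_apply, TransvectionStruct.toMatrix_mk,
      MeasurableEquiv.piFinSuccAbove_apply, hT]
    refine Prod.ext rfl (Prod.ext rfl ?_)
    funext j
    fin_cases j <;> rfl
  rw [hfun]
  exact h

/-- Disintegration of the entry chart over the marginal: the volume of a measurable set of
two-rebit matrices is the iterated integral, over the marginal coordinates `(a, b)`, of the volumes
of its fibres (Fubini after the measure-preserving change to base/fibre coordinates). [folklore] -/
theorem volume_eq_lintegral_fibre {S : Set (Fin 9 → ℝ)} (hS : MeasurableSet S) :
    volume S = ∫⁻ a : ℝ, ∫⁻ b : ℝ,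
      volume {v : Fin 7 → ℝ | (![v 0, v 1, v 2, a - v 0, b - v 2, v 3, v 4, v 5, v 6] : Fin 9 → ℝ) ∈ S} := by
  have hB : MeasurableSet ((fun p : ℝ × ℝ × (Fin 7 → ℝ) =>
      (![p.2.2 0, p.2.2 1, p.2.2 2, p.1 - p.2.2 0, p.2.1 - p.2.2 2, p.2.2 3, p.2.2 4, p.2.2 5, p.2.2 6] :
        Fin 9 → ℝ)) ⁻¹' S) :=
    measurable_baseFibre_symm hS
  have h1 : volume S = volume ((fun p : ℝ × ℝ × (Fin 7 → ℝ) =>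
      (![p.2.2 0, p.2.2 1, p.2.2 2, p.1 - p.2.2 0, p.2.1 - p.2.2 2, p.2.2 3, p.2.2 4, p.2.2 5, p.2.2 6] :
        Fin 9 → ℝ)) ⁻¹' S) := by
    rw [← measurePreserving_baseFibre.measure_preimage hB.nullMeasurableSet]
    congr 1
    ext y
    simp only [Set.mem_preimage]
    rw [baseFibre_apply_self]
  rw [h1, Measure.volume_eq_prod, Measure.prod_apply hB]
  refine lintegral_congr fun a => ?_
  rw [Measure.volume_eq_prod, Measure.prod_apply (measurable_prodMk_left hB)]
  rfl

/-- A faithful state has a faithful marginal: `ρ > 0 ⟹ D = Tr₁ ρ = X + Y > 0` (in base/fibre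
coordinates, `D = [[a, b], [b, 1 - a]]`). [folklore] -/
theorem posDef_marginal {a b : ℝ} {v : Fin 7 → ℝ}
    (h : (twoRebitMatrix ![v 0, v 1, v 2, a - v 0, b - v 2, v 3, v 4, v 5, v 6]).PosDef) :
    (!![a, b; b, 1 - a] : Matrix (Fin 2) (Fin 2) ℝ).PosDef := by
  refine Matrix.PosDef.of_dotProduct_mulVec_pos ?_ fun w hw => ?_
  · apply Matrix.IsHermitian.ext
    intro i j
    fin_cases i <;> fin_cases j <;> simp
  have ne : ∀ u : Fin 4 → ℝ, (∃ i, u i ≠ 0) → u ≠ 0 := fun u ⟨i, hi⟩ h => hi (by simp [h])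
  have hw' : w 0 ≠ 0 ∨ w 1 ≠ 0 := by
    by_contra hc
    push Not at hc
    apply hw
    funext i
    fin_cases i <;> simp [hc.1, hc.2]
  have h1 : 0 < ∑ i, (![w 0, w 1, 0, 0] : Fin 4 → ℝ) i *
      ∑ j, twoRebitMatrix ![v 0, v 1, v 2, a - v 0, b - v 2, v 3, v 4, v 5, v 6] i j * (![w 0, w 1, 0, 0] : Fin 4 → ℝ) j := by
    refine posDef_sum_pos_of_ne_zero h _ (ne _ ?_)
    rcases hw' with h0 | h0
    · exact ⟨0, by simpa using h0⟩
    · exact ⟨1, by simpa using h0⟩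
  have h2 : 0 < ∑ i, (![0, 0, w 0, w 1] : Fin 4 → ℝ) i *
      ∑ j, twoRebitMatrix ![v 0, v 1, v 2, a - v 0, b - v 2, v 3, v 4, v 5, v 6] i j * (![0, 0, w 0, w 1] : Fin 4 → ℝ) j := by
    refine posDef_sum_pos_of_ne_zero h _ (ne _ ?_)
    rcases hw' with h0 | h0
    · exact ⟨2, by simpa using h0⟩
    · exact ⟨3, by simpa using h0⟩
  simp [twoRebitMatrix, Fin.sum_univ_four] at h1 h2
  simp [Matrix.mulVec, dotProduct, Fin.sum_univ_two]
  nlinarith [h1, h2]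

/-- Existence of the normalising congruence: for a faithful qubit marginal `D = [[a, b], [b, 1-a]]`
there is an invertible (lower-triangular) `M` with `M D Mᵀ = ½·1`. [folklore] -/
theorem exists_conj_eq_half {a b : ℝ} (hD : (!![a, b; b, 1 - a] : Matrix (Fin 2) (Fin 2) ℝ).PosDef) :
    ∃ M M' : Matrix (Fin 2) (Fin 2) ℝ,
      M' * M = 1 ∧ M * !![a, b; b, 1 - a] * Mᵀ = !![1 / 2, 0; 0, 1 / 2] := by
  have ha : 0 < a := by simpa using hD.diag_pos (i := 0)
  have hΔ : 0 < a * (1 - a) - b * b := by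
    have := hD.det_pos
    rwa [Matrix.det_fin_two_of] at this
  obtain ⟨p, hp0, hp⟩ : ∃ p : ℝ, 0 < p ∧ p ^ 2 * (2 * a) = 1 := by
    refine ⟨Real.sqrt (1 / (2 * a)), Real.sqrt_pos.mpr (by positivity), ?_⟩
    rw [Real.sq_sqrt (by positivity)]
    exact one_div_mul_cancel (by positivity)
  obtain ⟨t, ht0, ht⟩ : ∃ t : ℝ, 0 < t ∧ t ^ 2 * (2 * a * (a * (1 - a) - b * b)) = 1 := by
    refine ⟨Real.sqrt (1 / (2 * a * (a * (1 - a) - b * b))), Real.sqrt_pos.mpr (by positivity), ?_⟩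
    rw [Real.sq_sqrt (by positivity)]
    exact one_div_mul_cancel (by positivity)
  have hp1 : p ≠ 0 := hp0.ne'
  refine ⟨!![p, 0; -(b * t), a * t], !![p⁻¹, 0; b * (p * a)⁻¹, (a * t)⁻¹], ?_, ?_⟩
  · ext i j
    fin_cases i <;> fin_cases j <;> simp [Matrix.mul_apply, Fin.sum_univ_two, hp1]
    all_goals (try field_simp)
    all_goals (try ring1)
  · ext i j
    fin_cases i <;> fin_cases j <;> simp [Matrix.mul_apply, Fin.sum_univ_two, hp1]
    all_goals
      first
      | ring1
      | linear_combination (1 / 2 : ℝ) * hp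
      | linear_combination (1 / 2 : ℝ) * ht

/-! #### Assembly -/

-- one declaration carrying 2 × 16 + 4 × 7 `fin_cases` matrix identities
set_option maxHeartbeats 1600000 in
/-- Fibrewise invariance (Lovas–Andai Thm. 1 / Cor. 2, restricted to what the reduction needs): for
every marginal `D = [[a, b], [b, 1 - a]]` there is one constant `c` (the Jacobian of the normalising
congruence; `0` if `D` is not faithful, the fibre then being empty) such that the fibre of the
two-rebit body over `D` has volume `c · Vol(𝒟_{4,ℝ}(½·1))` AND the fibre of its PPT part has
volume `c · Vol(𝒟ˢ_{4,ℝ}(½·1))`. Mechanism (proof of Thm. 1 in the source, substitution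
`Y = D^{-1/2} A D^{-1/2}`): with `M D Mᵀ = ½·1` and `B = 1 ⊗ M = diag(M, M)`, the congruence
`ρ ↦ B ρ Bᵀ` acts on the blocks by `(X, Z, Y) ↦ (M X Mᵀ, M Z Mᵀ, M Y Mᵀ)`, commutes with the partial
transpose `T` (`Z ↦ Zᵀ`), preserves positive definiteness, and maps the fibre over `D` linearly
(`cg M` below, in fibre coordinates) onto the fibre over `½·1`.
[cite: LovasAndai2017, Theorem 1 and Corollary 2] -/
theorem exists_fibre_volume_eq (a b : ℝ) :
    ∃ c : ℝ≥0∞,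
      volume {v : Fin 7 → ℝ | (twoRebitMatrix ![v 0, v 1, v 2, a - v 0, b - v 2, v 3, v 4, v 5, v 6]).PosDef} =
          c * volume {x : Fin 7 → ℝ | (rebitFibreMatrix x).PosDef} ∧
      volume {v : Fin 7 → ℝ | (twoRebitMatrix ![v 0, v 1, v 2, a - v 0, b - v 2, v 3, v 4, v 5, v 6]).PosDef ∧ (twoRebitMatrixPT ![v 0, v 1, v 2, a - v 0, b - v 2, v 3, v 4, v 5, v 6]).PosDef} =
          c * volume {x : Fin 7 → ℝ | (rebitFibreMatrix x).PosDef ∧ (rebitFibreMatrixPT x).PosDef} := by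
  by_cases hD : (!![a, b; b, 1 - a] : Matrix (Fin 2) (Fin 2) ℝ).PosDef
  swap
  · refine ⟨0, ?_, ?_⟩
    · have he : {v : Fin 7 → ℝ | (twoRebitMatrix ![v 0, v 1, v 2, a - v 0, b - v 2, v 3, v 4, v 5, v 6]).PosDef} = ∅ :=
        Set.subset_empty_iff.mp fun v hv => hD (posDef_marginal hv)
      rw [he, measure_empty, zero_mul]
    · have he : {v : Fin 7 → ℝ | (twoRebitMatrix ![v 0, v 1, v 2, a - v 0, b - v 2, v 3, v 4, v 5, v 6]).PosDef ∧ (twoRebitMatrixPT ![v 0, v 1, v 2, a - v 0, b - v 2, v 3, v 4, v 5, v 6]).PosDef} = ∅ :=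
        Set.subset_empty_iff.mp fun v hv => hD (posDef_marginal hv.1)
      rw [he, measure_empty, zero_mul]
  obtain ⟨M, M', hM, hMD⟩ := exists_conj_eq_half hD
  -- the congruence `(X, Z) ↦ (N X Nᵀ, N Z Nᵀ)` in fibre coordinates `v = (X₀₀, X₁₁, X₀₁, Z₀₀, Z₀₁, Z₁₀, Z₁₁)`
  set cg : Matrix (Fin 2) (Fin 2) ℝ → (Fin 7 → ℝ) → (Fin 7 → ℝ) := fun N v =>
    ![(N * !![v 0, v 2; v 2, v 1] * Nᵀ) 0 0, (N * !![v 0, v 2; v 2, v 1] * Nᵀ) 1 1,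
      (N * !![v 0, v 2; v 2, v 1] * Nᵀ) 0 1,
      (N * !![v 3, v 4; v 5, v 6] * Nᵀ) 0 0, (N * !![v 3, v 4; v 5, v 6] * Nᵀ) 0 1,
      (N * !![v 3, v 4; v 5, v 6] * Nᵀ) 1 0, (N * !![v 3, v 4; v 5, v 6] * Nᵀ) 1 1] with hcg
  -- the block-diagonal matrix `1 ⊗ N = diag(N, N)` (blocks indexed by the first tensor factor)
  set blk : Matrix (Fin 2) (Fin 2) ℝ → Matrix (Fin 4) (Fin 4) ℝ := fun N =>
    !![N 0 0, N 0 1, 0, 0; N 1 0, N 1 1, 0, 0; 0, 0, N 0 0, N 0 1; 0, 0, N 1 0, N 1 1] with hblk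
  have cg_cg : ∀ (N N' : Matrix (Fin 2) (Fin 2) ℝ) (v : Fin 7 → ℝ), cg N (cg N' v) = cg (N * N') v := by
    intro N N' v
    funext i
    fin_cases i <;> simp [hcg, Matrix.mul_apply, Fin.sum_univ_two] <;> ring
  have cg_one : ∀ v : Fin 7 → ℝ, cg 1 v = v := by
    intro v
    funext i
    fin_cases i <;> simp [hcg]
  have cg_add : ∀ (N : Matrix (Fin 2) (Fin 2) ℝ) (v w : Fin 7 → ℝ), cg N (v + w) = cg N v + cg N w := by
    intro N v w
    funext i
    fin_cases i <;> simp [hcg, Matrix.mul_apply, Fin.sum_univ_two] <;> ring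
  have cg_smul : ∀ (N : Matrix (Fin 2) (Fin 2) ℝ) (r : ℝ) (v : Fin 7 → ℝ), cg N (r • v) = r • cg N v := by
    intro N r v
    funext i
    fin_cases i <;> simp [hcg, Matrix.mul_apply, Fin.sum_univ_two] <;> ring
  -- the congruence by `M` is an invertible linear map of the fibre: constant Jacobian
  obtain ⟨c, hc⟩ : ∃ c : ℝ≥0∞, ∀ s : Set (Fin 7 → ℝ), volume (cg M ⁻¹' s) = c * volume s := by
    let L : (Fin 7 → ℝ) →ₗ[ℝ] (Fin 7 → ℝ) :=
      { toFun := cg M, map_add' := cg_add M, map_smul' := cg_smul M }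
    let L' : (Fin 7 → ℝ) →ₗ[ℝ] (Fin 7 → ℝ) :=
      { toFun := cg M', map_add' := cg_add M', map_smul' := cg_smul M' }
    have hcomp : L'.comp L = LinearMap.id := by
      apply LinearMap.ext
      intro v
      show cg M' (cg M v) = v
      rw [cg_cg, hM, cg_one]
    have hdet : LinearMap.det L ≠ 0 := by
      intro h0
      have h1 := congrArg LinearMap.det hcomp
      rw [LinearMap.det_comp, LinearMap.det_id, h0, mul_zero] at h1
      exact zero_ne_one h1
    exact ⟨_, fun s => Measure.addHaar_preimage_linearMap volume hdet s⟩
  -- `blk M` is invertible, so the congruence by it preserves positive definiteness both ways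
  have hU : IsUnit (blk M) := by
    refine IsUnit.of_mul_eq_one_right (blk M') ?_
    have e := fun i j => congr_fun (congr_fun hM i) j
    ext i j
    fin_cases i <;> fin_cases j <;>
      simp [hblk, Matrix.mul_apply, Fin.sum_univ_four, Fin.sum_univ_two, Matrix.one_apply] at e ⊢ <;>
      simp [e]
  have hconj : ∀ A : Matrix (Fin 4) (Fin 4) ℝ, (blk M * A * (blk M)ᵀ).PosDef ↔ A.PosDef := by
    intro A
    have h := Matrix.IsUnit.posDef_star_right_conjugate_iff (x := A) hU
    rwa [Matrix.star_eq_conjTranspose, Matrix.conjTranspose_eq_transpose_of_trivial] at h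
  -- the block identities `(1 ⊗ M) ρ (1 ⊗ M)ᵀ = ρ_fibre (cg M v)` and their partial-transposed twin
  have e00 := congr_fun (congr_fun hMD 0) 0
  have e01 := congr_fun (congr_fun hMD 0) 1
  have e10 := congr_fun (congr_fun hMD 1) 0
  have e11 := congr_fun (congr_fun hMD 1) 1
  simp [Matrix.mul_apply, Fin.sum_univ_two] at e00 e01 e10 e11
  have id1 : ∀ v : Fin 7 → ℝ,
      blk M * twoRebitMatrix ![v 0, v 1, v 2, a - v 0, b - v 2, v 3, v 4, v 5, v 6] * (blk M)ᵀ = rebitFibreMatrix (cg M v) := by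
    intro v
    ext i j
    fin_cases i <;> fin_cases j <;>
      simp [hcg, hblk, twoRebitMatrix, rebitFibreMatrix, Matrix.mul_apply, Fin.sum_univ_four,
        Fin.sum_univ_two] <;>
      first
      | ring1
      | linear_combination e00
      | linear_combination e01
      | linear_combination e10
      | linear_combination e11
  have id2 : ∀ v : Fin 7 → ℝ,
      blk M * twoRebitMatrixPT ![v 0, v 1, v 2, a - v 0, b - v 2, v 3, v 4, v 5, v 6] * (blk M)ᵀ = rebitFibreMatrixPT (cg M v) := by
    intro v
    ext i j
    fin_cases i <;> fin_cases j <;>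
      simp [hcg, hblk, twoRebitMatrixPT, rebitFibreMatrixPT, Matrix.mul_apply, Fin.sum_univ_four,
        Fin.sum_univ_two] <;>
      first
      | ring1
      | linear_combination e00
      | linear_combination e01
      | linear_combination e10
      | linear_combination e11
  refine ⟨c, ?_, ?_⟩
  · rw [← hc, Set.preimage_setOf_eq]
    congr 1
    ext v
    rw [Set.mem_setOf_eq, Set.mem_setOf_eq, ← hconj (twoRebitMatrix _), id1]
  · rw [← hc, Set.preimage_setOf_eq]
    congr 1
    ext v
    rw [Set.mem_setOf_eq, Set.mem_setOf_eq, ← hconj (twoRebitMatrix _), id1, ← hconj (twoRebitMatrixPT _),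
      id2]

/-- **Lovas–Andai 2017, Corollary 2 at `𝕂 = ℝ` (invariance of the separability probability over
the reduced state), in the form the reduction needs.** There is one constant `K ∈ [0, ∞]` with
`Vol(𝒟_{4,ℝ}) = K · Vol(𝒟_{4,ℝ}(½·1))` and `Vol(𝒟ˢ_{4,ℝ}) = K · Vol(𝒟ˢ_{4,ℝ}(½·1))` (entry chart `ℝ⁹`,
fibre chart `ℝ⁷`): every fibre `𝒟_{4,ℝ}(D)` is the image of the fibre over `½·1` under the linear
congruence `ρ ↦ (1 ⊗ M)ρ(1 ⊗ M)ᵀ`, `M D Mᵀ = ½·1`, which preserves `ρ > 0` and `T ρ > 0` and has a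
Jacobian depending on `D` only; then Fubini over `D`. [cite: LovasAndai2017, Theorem 1 and Corollary 2] -/
theorem rebit_volume_eq_const_mul_fibre_volume :
    ∃ K : ℝ≥0∞,
      volume {y : Fin 9 → ℝ | (twoRebitMatrix y).PosDef} =
          K * volume {x : Fin 7 → ℝ | (rebitFibreMatrix x).PosDef} ∧
      volume {y : Fin 9 → ℝ | (twoRebitMatrix y).PosDef ∧ (twoRebitMatrixPT y).PosDef} =
          K * volume {x : Fin 7 → ℝ | (rebitFibreMatrix x).PosDef ∧ (rebitFibreMatrixPT x).PosDef} := by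
  choose C hC using exists_fibre_volume_eq
  have hA7 : volume {x : Fin 7 → ℝ | (rebitFibreMatrix x).PosDef} ≠ ∞ :=
    volume_posDef_rebitFibre_lt_top.ne
  have hS7 : volume {x : Fin 7 → ℝ | (rebitFibreMatrix x).PosDef ∧ (rebitFibreMatrixPT x).PosDef} ≠ ∞ :=
    (lt_of_le_of_lt (measure_mono fun x hx => hx.1) volume_posDef_rebitFibre_lt_top).ne
  refine ⟨∫⁻ a : ℝ, ∫⁻ b : ℝ, C a b, ?_, ?_⟩
  · rw [volume_eq_lintegral_fibre measurableSet_posDef_twoRebit, ← lintegral_mul_const' _ _ hA7]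
    refine lintegral_congr fun a => ?_
    rw [← lintegral_mul_const' _ _ hA7]
    refine lintegral_congr fun b => ?_
    exact (hC a b).1
  · rw [volume_eq_lintegral_fibre measurableSet_ppt_twoRebit, ← lintegral_mul_const' _ _ hS7]
    refine lintegral_congr fun a => ?_
    rw [← lintegral_mul_const' _ _ hS7]
    refine lintegral_congr fun b => ?_
    exact (hC a b).2

/-- **Reduction of Lovas–Andai 2017, Theorem 2 to the fibre over the maximally mixed marginal.**
The two-rebit Hilbert–Schmidt separability probability (entry chart `ℝ⁹`) equals `29/64` as soon as
the conditional separability probability over `D = ½·1` (fibre chart `ℝ⁷`) does: this is exactly how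
Theorem 2 is proved in the source (`𝒫_sep(ℝ) = Vol(𝒟ˢ_{4,ℝ}(D)) / Vol(𝒟_{4,ℝ}(D))` for every `D`,
Corollary 2, then the value at the fibre). The remaining input is the named fact
`LovasAndai2017_rebit_fibre_separability_probability` (Lemma 6 + the integration of Thm. 2).
[cite: LovasAndai2017, Corollary 2 and Theorem 2] -/
theorem rebit_separability_probability_of_fibre
    (h : LovasAndai2017_rebit_fibre_separability_probability) :
    LovasAndai2017_rebit_separability_probability := by
  obtain ⟨K, hA, hS⟩ := rebit_volume_eq_const_mul_fibre_volume
  unfold LovasAndai2017_rebit_separability_probability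
  unfold LovasAndai2017_rebit_fibre_separability_probability at h
  rw [hA, hS]
  calc 64 * (K * volume {x : Fin 7 → ℝ | (rebitFibreMatrix x).PosDef ∧ (rebitFibreMatrixPT x).PosDef})
      = K * (64 * volume {x : Fin 7 → ℝ | (rebitFibreMatrix x).PosDef ∧
          (rebitFibreMatrixPT x).PosDef}) := by ring
    _ = K * (29 * volume {x : Fin 7 → ℝ | (rebitFibreMatrix x).PosDef}) := by rw [h]
    _ = 29 * (K * volume {x : Fin 7 → ℝ | (rebitFibreMatrix x).PosDef}) := by ring


/-! #### The converse reduction: the full-space and the fibre statements are equivalent -/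

/-- Every point of the two-rebit body lies in the cube `(-1, 1)⁹`. [folklore] -/
theorem abs_lt_one_of_posDef_twoRebitMatrix {y : Fin 9 → ℝ} (hy : (twoRebitMatrix y).PosDef)
    (i : Fin 9) : y i ∈ Set.Ioo (-1 : ℝ) 1 := by
  have q := fun w hw => posDef_sum_pos_of_ne_zero hy w hw
  have ne : ∀ w : Fin 4 → ℝ, (∃ i, w i ≠ 0) → w ≠ 0 := fun w ⟨i, hi⟩ h => hi (by simp [h])
  have h0 := q ![1, 0, 0, 0] (ne _ ⟨0, by simp⟩)
  have h1 := q ![0, 1, 0, 0] (ne _ ⟨1, by simp⟩)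
  have h2 := q ![0, 0, 1, 0] (ne _ ⟨2, by simp⟩)
  have h3 := q ![0, 0, 0, 1] (ne _ ⟨3, by simp⟩)
  have h4 := q ![1, 1, 0, 0] (ne _ ⟨0, by simp⟩)
  have h5 := q ![1, -1, 0, 0] (ne _ ⟨0, by simp⟩)
  have h6 := q ![1, 0, 1, 0] (ne _ ⟨0, by simp⟩)
  have h7 := q ![1, 0, -1, 0] (ne _ ⟨0, by simp⟩)
  have h8 := q ![1, 0, 0, 1] (ne _ ⟨0, by simp⟩)
  have h9 := q ![1, 0, 0, -1] (ne _ ⟨0, by simp⟩)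
  have h10 := q ![0, 1, 1, 0] (ne _ ⟨1, by simp⟩)
  have h11 := q ![0, 1, -1, 0] (ne _ ⟨1, by simp⟩)
  have h12 := q ![0, 1, 0, 1] (ne _ ⟨1, by simp⟩)
  have h13 := q ![0, 1, 0, -1] (ne _ ⟨1, by simp⟩)
  have h14 := q ![0, 0, 1, 1] (ne _ ⟨2, by simp⟩)
  have h15 := q ![0, 0, 1, -1] (ne _ ⟨2, by simp⟩)
  simp [twoRebitMatrix, Fin.sum_univ_four] at h0 h1 h2 h3 h4 h5 h6 h7 h8 h9 h10 h11 h12 h13 h14 h15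
  simp only [Set.mem_Ioo]
  fin_cases i <;> simp <;> constructor <;> nlinarith

/-- The two-rebit body has finite volume. [folklore] -/
theorem volume_posDef_twoRebit_lt_top :
    volume {y : Fin 9 → ℝ | (twoRebitMatrix y).PosDef} < ∞ := by
  refine lt_of_le_of_lt (measure_mono (t := Set.pi Set.univ fun _ => Set.Ioo (-1 : ℝ) 1) ?_) ?_
  · intro y hy
    exact fun i _ => abs_lt_one_of_posDef_twoRebitMatrix hy i
  · rw [volume_pi_pi]
    simp [Real.volume_Ioo]

/-- The two-rebit body has positive volume (it is open and contains `¼·1`). [folklore] -/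
theorem volume_posDef_twoRebit_pos :
    0 < volume {y : Fin 9 → ℝ | (twoRebitMatrix y).PosDef} := by
  refine (isOpen_setOf_posDef continuous_twoRebitMatrix isHermitian_twoRebitMatrix).measure_pos
    volume ⟨![1 / 4, 1 / 4, 0, 1 / 4, 0, 0, 0, 0, 0], ?_⟩
  have : twoRebitMatrix ![1 / 4, 1 / 4, 0, 1 / 4, 0, 0, 0, 0, 0] =
      Matrix.diagonal fun _ : Fin 4 => (1 / 4 : ℝ) := by
    ext i j
    fin_cases i <;> fin_cases j <;> simp [twoRebitMatrix, Matrix.diagonal]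
    norm_num
  rw [Set.mem_setOf_eq, this, Matrix.posDef_diagonal_iff]
  intro i
  norm_num

/-- The two-rebit fibre body has positive volume (it is open and contains `¼·1`). [folklore] -/
theorem volume_posDef_rebitFibre_pos :
    0 < volume {x : Fin 7 → ℝ | (rebitFibreMatrix x).PosDef} := by
  refine (isOpen_setOf_posDef continuous_rebitFibreMatrix isHermitian_rebitFibreMatrix).measure_pos
    volume ⟨![1 / 4, 1 / 4, 0, 0, 0, 0, 0], ?_⟩
  have : rebitFibreMatrix ![1 / 4, 1 / 4, 0, 0, 0, 0, 0] =
      Matrix.diagonal fun _ : Fin 4 => (1 / 4 : ℝ) := by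
    ext i j
    fin_cases i <;> fin_cases j <;> simp [rebitFibreMatrix, Matrix.diagonal] <;> norm_num
  rw [Set.mem_setOf_eq, this, Matrix.posDef_diagonal_iff]
  intro i
  norm_num

/-- The constant of `rebit_volume_eq_const_mul_fibre_volume` is automatically
positive and finite (both bodies are bounded open sets), so the two-rebit separability probability
and its conditional version over the maximally mixed marginal are the SAME number:
**Lovas–Andai 2017, Corollary 2 at `𝕂 = ℝ`, `D = ½·1`,** as an equivalence of the two named facts
(Theorem 2 on the entry chart `ℝ⁹` ⟺ its fibre version on `ℝ⁷`).
[cite: LovasAndai2017, Corollary 2 and Theorem 2] -/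
theorem rebit_separability_probability_iff_fibre :
    LovasAndai2017_rebit_separability_probability ↔
      LovasAndai2017_rebit_fibre_separability_probability := by
  obtain ⟨K, hA, hS⟩ := rebit_volume_eq_const_mul_fibre_volume
  have hK0 : K ≠ 0 := by
    intro h
    rw [h, zero_mul] at hA
    exact volume_posDef_twoRebit_pos.ne' hA
  have hKtop : K ≠ ∞ := by
    intro h
    rw [h, ENNReal.top_mul volume_posDef_rebitFibre_pos.ne'] at hA
    exact volume_posDef_twoRebit_lt_top.ne hA
  unfold LovasAndai2017_rebit_separability_probability
    LovasAndai2017_rebit_fibre_separability_probability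
  rw [hA, hS]
  constructor
  · intro h
    refine (ENNReal.mul_right_inj hK0 hKtop).mp ?_
    calc K * (64 * volume {x : Fin 7 → ℝ | (rebitFibreMatrix x).PosDef ∧ (rebitFibreMatrixPT x).PosDef})
        = 64 * (K * volume {x : Fin 7 → ℝ | (rebitFibreMatrix x).PosDef ∧
            (rebitFibreMatrixPT x).PosDef}) := by ring
      _ = 29 * (K * volume {x : Fin 7 → ℝ | (rebitFibreMatrix x).PosDef}) := h
      _ = K * (29 * volume {x : Fin 7 → ℝ | (rebitFibreMatrix x).PosDef}) := by ring
  · intro h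
    calc 64 * (K * volume {x : Fin 7 → ℝ | (rebitFibreMatrix x).PosDef ∧ (rebitFibreMatrixPT x).PosDef})
        = K * (64 * volume {x : Fin 7 → ℝ | (rebitFibreMatrix x).PosDef ∧
            (rebitFibreMatrixPT x).PosDef}) := by ring
      _ = K * (29 * volume {x : Fin 7 → ℝ | (rebitFibreMatrix x).PosDef}) := by rw [h]
      _ = 29 * (K * volume {x : Fin 7 → ℝ | (rebitFibreMatrix x).PosDef}) := by ring

/-- The converse reduction: the fibre statement follows from the full-space one.
[cite: LovasAndai2017, Corollary 2 and Theorem 2] -/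
theorem rebit_fibre_separability_probability_of_full
    (h : LovasAndai2017_rebit_separability_probability) :
    LovasAndai2017_rebit_fibre_separability_probability :=
  rebit_separability_probability_iff_fibre.mp h

end Literature.Probability.RandomMatrix.LovasAndai2017
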